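import Summits.AtomisticToContinuum.Crystallization.Theorems.ThreeConeCertificateExactCertificateFieldSummable
import Summits.AtomisticToContinuum.Crystallization.Theorems.ThreeConeCertificateExactCertificateFieldPeriodic

/-!
# `ExactCertificate` (stmt-AtomisticToContinuum-11959): lattice periodisation of a positive-type
# radial kernel, II — a neutral crystal is invisible

Let `P = F + G` be a periodic configuration of `ℝ³` and `f : ℝ → ℝ` a radial kernel whose coset
sums `S(v) = Σ_d f(dist v (latVec d))` over the lattice of periods converge.  The point set is the
disjoint union of the cosets `x + G`, `x ∈ F` (`bijective_cosetMap`), so the `f`-field of the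
crystal at `w ∈ ℝ³` is `T(w) = Σ_{y ∈ P} f(dist w y) = Σ_{x ∈ F} S(w − x)` (`field_hasSum`), and
the site sums of the energy per particle are `siteSum f x = T(x) − f 0` (`siteSum_eq_field_sub`).
If the periodisation `S` is of positive type (`Σᵢⱼ wᵢ wⱼ S(uᵢ − uⱼ) ≥ 0` for all finite weighted
families) and the crystal is `f`-neutral on average over the motif, `f 0 + 2 e_f(P) = 0` —
equivalently `Σ_{x, x' ∈ F} S(x − x') = 0` (`sum_motif_field_eq_zero`) — then the whole field
vanishes identically: `Σ_{y ∈ P} f(dist w y) = 0` for every `w ∈ ℝ³` (`field_hasSum_zero`).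
The proof is the quadratic trick (`sum_eq_zero_of_posType`): testing positivity on the motif
together with the extra point `w` carrying a charge `t` gives `0 ≤ S(0) t² + 2 T(w) t` for all
real `t`, whence `T(w) = 0`.

With parts 0–I (`…FieldSummable`, `…FieldPeriodic`: every coset family of an eventually
non-positive positive-type `f` is summable, and its periodisation is of positive type) this gives
the registered stub `stub_invisible` and, by complementary slackness (`stub_coneEnergies` (iii):
`f 0 + 2e_f(P) = 0` for a witness), **THE INVISIBILITY THEOREM FOR WITNESSES OF THE CRUX**
(`invisible_of_isSplit`): for a split `(ρ, c, g, U, f)` attaining a periodic `P`, the `f`-field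
generated by the whole crystal vanishes at EVERY point of space, `Σ_{y ∈ P} f(dist w y) = 0`
(the Fourier-free form of "`𝓕f · S_F = 0` on the entire reciprocal lattice, `k = 0` included";
strictly stronger than the scalar identity: every site of a non-Bravais template is individually
`f`-neutral, `siteSum_eq_neg_f_zero_of_isSplit`).  All `[folklore]`.
-/

noncomputable section

namespace Summit.AtomisticToContinuum.Crystallization.Theorems.ThreeConeCertificateExactCertificate.Field

open Literature.MathematicalPhysics.StatisticalMechanics
open Summit.AtomisticToContinuum.Crystallization.Theorems.ChargedEnergyGapNegative (E3)
open Summit.AtomisticToContinuum.Crystallization.Theorems.ChargedEnergyGapNegative.Blocks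
  (latVec latVec_mem latVec_add latVec_sub latVec_neg latVec_zero latVec_injective exists_latVec_eq
    siteSum siteSum_add sum_siteSum_eq)
open Summit.AtomisticToContinuum.Crystallization.Theorems.ExactCertificateNegative (IsSplit)
open Filter Topology
open scoped BigOperators

/-! ## The point set as the disjoint union of the motif cosets -/

/-- **Coset decomposition of the point set.** `(x, d) ↦ x + latVec d` is a bijection from
`F × ℤ³` onto the point set `F + G`: injective because motif points are pairwise inequivalent
modulo `G` and `latVec` is injective, surjective by the definition of `F + G`. [folklore] -/
theorem bijective_cosetMap (P : PeriodicConfiguration 3) :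
    Function.Bijective fun p : P.motif × (Fin 3 → ℤ) =>
      (⟨(p.1 : E3) + latVec P p.2,
        P.add_mem_points (P.mem_points_of_mem_motif p.1.2) (latVec_mem P p.2)⟩ : P.points) := by
  refine ⟨?_, ?_⟩
  · rintro ⟨x, d⟩ ⟨x', d'⟩ h
    have h' : (x : E3) + latVec P d = x' + latVec P d' := congrArg Subtype.val h
    have hsub : (x : E3) - x' = latVec P (d' - d) := by
      rw [latVec_sub, sub_eq_sub_iff_add_eq_add, h', add_comm]
    have hmem : (x : E3) - x' ∈ P.lattice := by
      rw [hsub]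
      exact latVec_mem P _
    have hx : (x : E3) = x' := P.eq_of_sub_mem x x.2 x' x'.2 hmem
    have hd : latVec P d = latVec P d' := by
      rw [hx] at h'
      exact add_left_cancel h'
    exact Prod.ext (Subtype.ext hx) (latVec_injective P hd)
  · rintro ⟨y, x, hx, g, hg, rfl⟩
    obtain ⟨d, rfl⟩ := exists_latVec_eq P hg
    exact ⟨(⟨x, hx⟩, d), rfl⟩

/-- The distance from `w` to the shifted point `x + g` is the distance from `w − x` to `g`.
[folklore] -/
theorem dist_add_right_eq (w x g : E3) : dist w (x + g) = dist (w - x) g := by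
  rw [dist_sub_eq_dist_add_left, add_comm]

/-- Summing a family on a product `ι × γ` with finite first factor slice by slice: if every slice
`c ↦ g (i, c)` has sum `a i`, the whole family has sum `Σ_i a i`. [folklore] -/
theorem hasSum_prod_of_fintype {ι γ : Type*} [Fintype ι] {g : ι × γ → ℝ} {a : ι → ℝ}
    (h : ∀ i, HasSum (fun c => g (i, c)) (a i)) : HasSum g (∑ i, a i) := by
  classical
  have key : ∀ i, HasSum (fun p : ι × γ => if p.1 = i then g p else 0) (a i) := by
    intro i
    have hinj : Function.Injective (Prod.mk i : γ → ι × γ) := fun c c' hc =>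
      congrArg Prod.snd hc
    have hvan : ∀ p ∉ Set.range (Prod.mk i : γ → ι × γ), (if p.1 = i then g p else 0) = 0 := by
      rintro ⟨j, c⟩ hp
      rw [if_neg]
      rintro rfl
      exact hp ⟨c, rfl⟩
    refine (hinj.hasSum_iff hvan).1 ?_
    convert h i using 1
    funext c
    simp
  convert hasSum_sum (s := Finset.univ) fun i _ => key i using 1
  funext p
  simp

/-- **The field as a finite sum of coset sums.** For every `w ∈ ℝ³` the family
`y ↦ f(dist w y)` on the point set has the sum `T(w) = Σ_{x ∈ F} Σ_d f(dist (w − x) (latVec d))`,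
provided the coset sums converge. [folklore] -/
theorem field_hasSum (P : PeriodicConfiguration 3) (f : ℝ → ℝ)
    (hs : ∀ v : E3, Summable fun d : Fin 3 → ℤ => f (dist v (latVec P d))) (w : E3) :
    HasSum (fun y : P.points => f (dist w (y : E3)))
      (∑ x ∈ P.motif, ∑' d : Fin 3 → ℤ, f (dist (w - x) (latVec P d))) := by
  have hprod : HasSum (fun p : P.motif × (Fin 3 → ℤ) => f (dist (w - p.1) (latVec P p.2)))
      (∑ x : P.motif, ∑' d : Fin 3 → ℤ, f (dist (w - x) (latVec P d))) :=
    hasSum_prod_of_fintype fun x : P.motif => (hs (w - x)).hasSum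
  rw [← Finset.sum_coe_sort P.motif, ← (Equiv.ofBijective _ (bijective_cosetMap P)).hasSum_iff]
  convert hprod using 1
  funext p
  simp only [Function.comp_apply, Equiv.ofBijective_apply, dist_add_right_eq]

/-! ## Site sums, and neutrality on average over the motif -/

/-- **Site sums are fields minus the self term**: at a motif point `x`,
`siteSum f x = Σ_{y ∈ P, y ≠ x} f(dist x y) = T(x) − f 0`. [folklore] -/
theorem siteSum_eq_field_sub (P : PeriodicConfiguration 3) (f : ℝ → ℝ)
    (hs : ∀ v : E3, Summable fun d : Fin 3 → ℤ => f (dist v (latVec P d))) {x : E3}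
    (hx : x ∈ P.motif) :
    siteSum P f x = (∑ x' ∈ P.motif, ∑' d : Fin 3 → ℤ, f (dist (x - x') (latVec P d))) - f 0 := by
  classical
  set x₀ : P.points := ⟨x, P.mem_points_of_mem_motif hx⟩
  have h1 := hasSum_ite_sub_hasSum (field_hasSum P f hs x) x₀
  rw [show dist x (x₀ : E3) = 0 from dist_self x] at h1
  have hι : Function.Injective
      (fun q : {q : E3 // q ∈ P.points ∧ q ≠ x} => (⟨q.1, q.2.1⟩ : P.points)) :=
    fun q q' h => by
    have h' := congrArg Subtype.val h
    exact Subtype.ext h'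
  have hvan : ∀ y ∉ Set.range
      (fun q : {q : E3 // q ∈ P.points ∧ q ≠ x} => (⟨q.1, q.2.1⟩ : P.points)),
      (if y = x₀ then (0 : ℝ) else f (dist x (y : E3))) = 0 := by
    intro y hy
    rw [if_pos]
    by_contra hne
    exact hy ⟨⟨y.1, y.2, fun h => hne (Subtype.ext h)⟩, rfl⟩
  have h2 := (hι.hasSum_iff hvan).2 h1
  unfold siteSum
  refine HasSum.tsum_eq ?_
  convert h2 using 1
  funext q
  rw [Function.comp_apply, if_neg]
  exact fun h => q.2.2 (congrArg Subtype.val h)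

/-- **Neutrality on average over the motif.** If `f 0 + 2 e_f(P) = 0`, then
`Σ_{x ∈ F} Σ_{x' ∈ F} S(x − x') = Σ_{x ∈ F} (siteSum f x + f 0) = #F · (2 e_f(P) + f 0) = 0`.
[folklore] -/
theorem sum_motif_field_eq_zero (P : PeriodicConfiguration 3) (f : ℝ → ℝ)
    (hs : ∀ v : E3, Summable fun d : Fin 3 → ℤ => f (dist v (latVec P d)))
    (hzero : f 0 + 2 * P.energyPerParticle f = 0) :
    ∑ x ∈ P.motif, ∑ x' ∈ P.motif, ∑' d : Fin 3 → ℤ, f (dist (x - x') (latVec P d)) = 0 := by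
  have h1 : ∀ x ∈ P.motif, ∑ x' ∈ P.motif, ∑' d : Fin 3 → ℤ, f (dist (x - x') (latVec P d)) =
      siteSum P f x + f 0 := fun x hx => by
    rw [siteSum_eq_field_sub P f hs hx, sub_add_cancel]
  rw [Finset.sum_congr rfl h1, Finset.sum_add_distrib, sum_siteSum_eq, Finset.sum_const,
    nsmul_eq_mul]
  linear_combination (P.motif.card : ℝ) * hzero

/-! ## Evenness of the coset sums and the quadratic trick -/

/-- **The coset sums are even**: `S(−v) = S(v)` (reindex `d ↦ −d`). [folklore] -/
theorem cosetSum_neg (P : PeriodicConfiguration 3) (f : ℝ → ℝ) (v : E3) :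
    ∑' d : Fin 3 → ℤ, f (dist (-v) (latVec P d)) = ∑' d : Fin 3 → ℤ, f (dist v (latVec P d)) := by
  rw [← (Equiv.neg (Fin 3 → ℤ)).tsum_eq]
  refine tsum_congr fun d => ?_
  rw [Equiv.neg_apply, latVec_neg, dist_neg_neg]

/-- If `a ≥ 0` and `a t² + 2 b t ≥ 0` for every real `t`, then `b = 0`
(test `t = −b / (a + 1)`). [folklore] -/
theorem eq_zero_of_forall_quad_nonneg {a b : ℝ} (ha : 0 ≤ a)
    (h : ∀ t : ℝ, 0 ≤ a * t ^ 2 + 2 * b * t) : b = 0 := by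
  have ha1 : 0 < a + 1 := by linarith
  set s := -b / (a + 1) with hs
  have hsb : s * (a + 1) = -b := by
    rw [hs]
    exact div_mul_cancel₀ (-b) ha1.ne'
  have hb : b = -(s * (a + 1)) := by rw [hsb, neg_neg]
  have h1 : 0 ≤ a * s ^ 2 + 2 * b * s := h s
  have h2 : a * s ^ 2 + 2 * b * s = -(s ^ 2 * (a + 2)) := by
    rw [hb]
    ring
  have h3 : s ^ 2 ≤ 0 := by linarith [mul_nonneg (sq_nonneg s) ha]
  have hs0 : s = 0 := (pow_eq_zero_iff two_ne_zero).1 (le_antisymm h3 (sq_nonneg s))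
  rw [hb, hs0, zero_mul, neg_zero]

/-- **The quadratic trick.** Let `S : ℝ³ → ℝ` be even and of positive type
(`Σᵢⱼ Wᵢ Wⱼ S(uᵢ − uⱼ) ≥ 0` for all finite weighted families) and let `F` be a finite set with
`Σ_{x, x' ∈ F} S(x − x') = 0`.  Then `Σ_{x ∈ F} S(w − x) = 0` for every `w`: testing positivity on
`F` (weights `1`) together with `w` (weight `t`) gives `0 ≤ S(0) t² + 2 t Σ_{x ∈ F} S(w − x)` for
all real `t`. [folklore] -/
theorem sum_eq_zero_of_posType (S : E3 → ℝ) (F : Finset E3)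
    (hA : ∀ (n : ℕ) (u : Fin n → E3) (W : Fin n → ℝ), 0 ≤ ∑ i, ∑ j, W i * W j * S (u i - u j))
    (hneg : ∀ v, S (-v) = S v) (hF : ∑ x ∈ F, ∑ x' ∈ F, S (x - x') = 0) (w : E3) :
    ∑ x ∈ F, S (w - x) = 0 := by
  have hsum : ∀ g : E3 → ℝ, ∑ i, g (F.equivFin.symm i) = ∑ x ∈ F, g x := fun g => by
    rw [← Finset.sum_coe_sort F]
    exact F.equivFin.symm.sum_comp (fun x : F => g x)
  have h0 : 0 ≤ S 0 := by simpa using hA 1 (fun _ => 0) (fun _ => 1)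
  refine eq_zero_of_forall_quad_nonneg h0 fun t => ?_
  have key := hA (F.card + 1) (Matrix.vecCons w fun i => (F.equivFin.symm i : E3))
    (Matrix.vecCons t fun _ => 1)
  simp only [Fin.sum_univ_succ, Matrix.cons_val_zero, Matrix.cons_val_succ, one_mul, mul_one,
    sub_self, Finset.sum_add_distrib, ← Finset.mul_sum] at key
  have h1 : ∑ i, S (w - F.equivFin.symm i) = ∑ x ∈ F, S (w - x) := hsum fun x => S (w - x)
  have h2 : ∑ i, S (F.equivFin.symm i - w) = ∑ x ∈ F, S (w - x) := by
    rw [← h1]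
    exact Finset.sum_congr rfl fun i _ => by rw [← neg_sub, hneg]
  have h3 : ∑ i, ∑ j, S ((F.equivFin.symm i : E3) - F.equivFin.symm j) = 0 := by
    rw [← hF, ← hsum fun x => ∑ x' ∈ F, S (x - x')]
    exact Finset.sum_congr rfl fun i _ => hsum fun x' => S (F.equivFin.symm i - x')
  rw [h1, h2, h3] at key
  linarith

/-- Discriminant form of the quadratic trick: if `a ≥ 0` and `a t² + 2 b t + c ≥ 0` for every real
`t`, then `b² ≤ a c`. [folklore] -/
theorem sq_le_mul_of_forall_quad_nonneg {a b c : ℝ} (ha : 0 ≤ a)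
    (h : ∀ t : ℝ, 0 ≤ a * t ^ 2 + 2 * b * t + c) : b ^ 2 ≤ a * c := by
  rcases ha.eq_or_lt with ha0 | hapos
  · -- `a = 0`: the linear function `2bt + c` is bounded below only if `b = 0`
    have hb : b = 0 := by
      by_contra hb
      have h1 := h (-(c + 1) / (2 * b))
      rw [← ha0] at h1
      have : 2 * b * (-(c + 1) / (2 * b)) = -(c + 1) := by field_simp
      linarith
    rw [hb, ← ha0]; simp
  · have h1 := h (-b / a)
    have e : a * (-b / a) ^ 2 + 2 * b * (-b / a) + c = c - b ^ 2 / a := by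
      field_simp; ring
    rw [e, sub_nonneg, div_le_iff₀ hapos] at h1
    linarith

/-- **Approximate invisibility (for the moving template of `stub_noGap`).** For an even positive-type
`S` and any finite `F`, `(Σ_{x ∈ F} S(w − x))² ≤ S(0) · Σ_{x,x' ∈ F} S(x − x')` for every `w`: a
nearly neutral crystal has a uniformly small field. [folklore] -/
theorem sq_sum_le_of_posType (S : E3 → ℝ) (F : Finset E3)
    (hA : ∀ (n : ℕ) (u : Fin n → E3) (W : Fin n → ℝ), 0 ≤ ∑ i, ∑ j, W i * W j * S (u i - u j))
    (hneg : ∀ v, S (-v) = S v) (w : E3) :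
    (∑ x ∈ F, S (w - x)) ^ 2 ≤ S 0 * ∑ x ∈ F, ∑ x' ∈ F, S (x - x') := by
  have hsum : ∀ g : E3 → ℝ, ∑ i, g (F.equivFin.symm i) = ∑ x ∈ F, g x := fun g => by
    rw [← Finset.sum_coe_sort F]
    exact F.equivFin.symm.sum_comp (fun x : F => g x)
  have h0 : 0 ≤ S 0 := by simpa using hA 1 (fun _ => 0) (fun _ => 1)
  refine sq_le_mul_of_forall_quad_nonneg h0 fun t => ?_
  have key := hA (F.card + 1) (Matrix.vecCons w fun i => (F.equivFin.symm i : E3))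
    (Matrix.vecCons t fun _ => 1)
  simp only [Fin.sum_univ_succ, Matrix.cons_val_zero, Matrix.cons_val_succ, one_mul, mul_one,
    sub_self, Finset.sum_add_distrib, ← Finset.mul_sum] at key
  have h1 : ∑ i, S (w - F.equivFin.symm i) = ∑ x ∈ F, S (w - x) := hsum fun x => S (w - x)
  have h2 : ∑ i, S (F.equivFin.symm i - w) = ∑ x ∈ F, S (w - x) := by
    rw [← h1]
    exact Finset.sum_congr rfl fun i _ => by rw [← neg_sub, hneg]
  have h3 : ∑ i, ∑ j, S ((F.equivFin.symm i : E3) - F.equivFin.symm j) =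
      ∑ x ∈ F, ∑ x' ∈ F, S (x - x') := by
    rw [← hsum fun x => ∑ x' ∈ F, S (x - x')]
    exact Finset.sum_congr rfl fun i _ => hsum fun x' => S (F.equivFin.symm i - x')
  rw [h1, h2, h3] at key
  linarith

/-- **Approximate invisibility for a nearly neutral crystal.** If the coset families converge and the
periodisation is of positive type, then for every `w`
`T(w)² ≤ S(0) · #F · (f 0 + 2e_f(P))`, where `T(w) = Σ_{x∈F} S(w − x)` is the field and
`S(0) = f 0 + Σ_{g ∈ G∖0} f(|g|)`; with tail slack `≤ δ` in `stub_noGap` one has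
`0 ≤ f 0 + 2e_Q(f) ≤ δ`, so the field of the template is `O(√δ)` uniformly in space. [folklore] -/
theorem field_sq_le (P : PeriodicConfiguration 3) (f : ℝ → ℝ)
    (hs : ∀ v : E3, Summable fun d : Fin 3 → ℤ => f (dist v (latVec P d)))
    (hA : ∀ (n : ℕ) (u : Fin n → E3) (w : Fin n → ℝ),
      0 ≤ ∑ i, ∑ j, w i * w j * ∑' d : Fin 3 → ℤ, f (dist (u i - u j) (latVec P d)))
    (w : E3) :
    (∑ x ∈ P.motif, ∑' d : Fin 3 → ℤ, f (dist (w - x) (latVec P d))) ^ 2 ≤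
      (∑' d : Fin 3 → ℤ, f (dist (0 : E3) (latVec P d))) *
        (P.motif.card * (f 0 + 2 * P.energyPerParticle f)) := by
  have h1 : ∀ x ∈ P.motif, ∑ x' ∈ P.motif, ∑' d : Fin 3 → ℤ, f (dist (x - x') (latVec P d)) =
      siteSum P f x + f 0 := fun x hx => by
    rw [siteSum_eq_field_sub P f hs hx, sub_add_cancel]
  have h2 : ∑ x ∈ P.motif, ∑ x' ∈ P.motif, ∑' d : Fin 3 → ℤ, f (dist (x - x') (latVec P d)) =
      P.motif.card * (f 0 + 2 * P.energyPerParticle f) := by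
    rw [Finset.sum_congr rfl h1, Finset.sum_add_distrib, sum_siteSum_eq, Finset.sum_const,
      nsmul_eq_mul]
    ring
  rw [← h2]
  exact sq_sum_le_of_posType (fun v => ∑' d : Fin 3 → ℤ, f (dist v (latVec P d))) P.motif hA
    (cosetSum_neg P f) w

/-! ## The field of a neutral crystal vanishes -/

/-- **The field of a neutral crystal vanishes**: if the lattice periodisation of `f` is of
positive type and `f 0 + 2 e_f(P) = 0`, then `T(w) = Σ_{x ∈ F} Σ_d f(dist (w − x) (latVec d)) = 0`
for every `w ∈ ℝ³`. [folklore] -/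
theorem field_eq_zero (P : PeriodicConfiguration 3) (f : ℝ → ℝ)
    (hs : ∀ v : E3, Summable fun d : Fin 3 → ℤ => f (dist v (latVec P d)))
    (hA : ∀ (n : ℕ) (u : Fin n → E3) (w : Fin n → ℝ),
      0 ≤ ∑ i, ∑ j, w i * w j * ∑' d : Fin 3 → ℤ, f (dist (u i - u j) (latVec P d)))
    (hzero : f 0 + 2 * P.energyPerParticle f = 0) (w : E3) :
    ∑ x ∈ P.motif, ∑' d : Fin 3 → ℤ, f (dist (w - x) (latVec P d)) = 0 :=
  sum_eq_zero_of_posType (fun v => ∑' d : Fin 3 → ℤ, f (dist v (latVec P d))) P.motif hA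
    (cosetSum_neg P f) (sum_motif_field_eq_zero P f hs hzero) w

/-- **A neutral crystal is invisible.** If the lattice periodisation
`S(v) = Σ_d f(dist v (latVec d))` of the radial kernel `f` converges everywhere and is of positive
type, and the crystal is `f`-neutral on average over the motif (`f 0 + 2 e_f(P) = 0`), then the
whole `f`-field of the crystal vanishes identically: `Σ_{y ∈ P} f(dist w y) = 0` for every
`w ∈ ℝ³` (as an unconditional sum over the point set). [folklore] -/
theorem field_hasSum_zero (P : PeriodicConfiguration 3) (f : ℝ → ℝ)
    (hs : ∀ v : E3, Summable fun d : Fin 3 → ℤ => f (dist v (latVec P d)))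
    (hA : ∀ (n : ℕ) (u : Fin n → E3) (w : Fin n → ℝ),
      0 ≤ ∑ i, ∑ j, w i * w j * ∑' d : Fin 3 → ℤ, f (dist (u i - u j) (latVec P d)))
    (hzero : f 0 + 2 * P.energyPerParticle f = 0) :
    ∀ w : E3, HasSum (fun y : P.points => f (dist w (y : E3))) 0 := by
  intro w
  have h := field_hasSum P f hs w
  rwa [field_eq_zero P f hs hA hzero w] at h

/-- Corollary: the `f`-field is summable over the point set and its sum is `0`. [folklore] -/
theorem field_tsum_eq_zero (P : PeriodicConfiguration 3) (f : ℝ → ℝ)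
    (hs : ∀ v : E3, Summable fun d : Fin 3 → ℤ => f (dist v (latVec P d)))
    (hA : ∀ (n : ℕ) (u : Fin n → E3) (w : Fin n → ℝ),
      0 ≤ ∑ i, ∑ j, w i * w j * ∑' d : Fin 3 → ℤ, f (dist (u i - u j) (latVec P d)))
    (hzero : f 0 + 2 * P.energyPerParticle f = 0) (w : E3) :
    (Summable fun y : P.points => f (dist w (y : E3))) ∧
      ∑' y : P.points, f (dist w (y : E3)) = 0 :=
  ⟨(field_hasSum_zero P f hs hA hzero w).summable, (field_hasSum_zero P f hs hA hzero w).tsum_eq⟩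

/-- Corollary: in particular every site sum of `f` equals `−f 0`:
`Σ_{y ∈ P, y ≠ x} f(dist x y) = −f 0` at every motif point `x`. [folklore] -/
theorem siteSum_eq_neg (P : PeriodicConfiguration 3) (f : ℝ → ℝ)
    (hs : ∀ v : E3, Summable fun d : Fin 3 → ℤ => f (dist v (latVec P d)))
    (hA : ∀ (n : ℕ) (u : Fin n → E3) (w : Fin n → ℝ),
      0 ≤ ∑ i, ∑ j, w i * w j * ∑' d : Fin 3 → ℤ, f (dist (u i - u j) (latVec P d)))
    (hzero : f 0 + 2 * P.energyPerParticle f = 0) {x : E3} (hx : x ∈ P.motif) :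
    siteSum P f x = -f 0 := by
  rw [siteSum_eq_field_sub P f hs hx, field_eq_zero P f hs hA hzero x, zero_sub]

/-! ## The invisibility theorem -/

/-- **For the `f` of a split the lattice periodisation is of positive type** (parts 0 + I).
[folklore] -/
theorem periodisation_posType_of_isSplit (P : PeriodicConfiguration 3) {ρ c : ℝ} {g U f : ℝ → ℝ}
    (h : IsSplit ρ c g U f) (n : ℕ) (u : Fin n → E3) (w : Fin n → ℝ) :
    0 ≤ ∑ i, ∑ j, w i * w j * ∑' d : Fin 3 → ℤ, f (dist (u i - u j) (latVec P d)) :=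
  periodisation_posType P f h.posType (summable_coset_of_isSplit P h) n u w

/-- **Invisibility (general form).** A positive-type radial `f` on `ℝ³` that is eventually
non-positive and for which the crystal `P` is neutral on average over the motif
(`f 0 + 2e_f(P) = 0`) has identically vanishing crystal field: `Σ_{y ∈ P} f(dist w y) = 0` for
every `w ∈ ℝ³`. [folklore] -/
theorem invisible (P : PeriodicConfiguration 3) {f : ℝ → ℝ}
    (hpd : ∀ (n : ℕ) (y : Fin n → E3) (w : Fin n → ℝ),
      0 ≤ ∑ i, ∑ j, w i * w j * f (dist (y i) (y j)))
    {R : ℝ} (hR : ∀ r : ℝ, R ≤ r → f r ≤ 0) (hzero : f 0 + 2 * P.energyPerParticle f = 0)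
    (w : E3) : HasSum (fun y : P.points => f (dist w (y : E3))) 0 :=
  field_hasSum_zero P f (summable_coset P hpd hR)
    (periodisation_posType P f hpd (summable_coset P hpd hR)) hzero w

/-- **Registered stub `stub_invisible` of crux item stmt-AtomisticToContinuum-11959** (line
`closure-makes-nogap-exact`, necessity side; signature verbatim) = `invisible`. [folklore] -/
theorem stub_invisible : ∀ (P : PeriodicConfiguration 3) (f : ℝ → ℝ),
    (∀ (n : ℕ) (y : Fin n → EuclideanSpace ℝ (Fin 3)) (w : Fin n → ℝ),
      0 ≤ ∑ i, ∑ j, w i * w j * f (dist (y i) (y j))) → ∀ R : ℝ, (∀ r : ℝ, R ≤ r → f r ≤ 0) →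
    f 0 + 2 * P.energyPerParticle f = 0 →
    ∀ w : EuclideanSpace ℝ (Fin 3), HasSum (fun y : P.points => f (dist w (y : EuclideanSpace ℝ (Fin 3)))) 0 :=
  fun P _ hpd _ hR hzero w => invisible P hpd hR hzero w

/-- **THE INVISIBILITY THEOREM FOR WITNESSES OF `ExactCertificate`.** For a three-cone split
`(ρ, c, g, U, f)` of `V_LJ` attaining a periodic configuration `P` (`c + f 0/2 ≤ −e(P)`), the
`f`-field of the whole crystal vanishes at every point of space:
`Σ_{y ∈ P} f(dist w y) = 0` for every `w ∈ ℝ³`. [folklore] -/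
theorem invisible_of_isSplit {P : PeriodicConfiguration 3} {ρ c : ℝ} {g U f : ℝ → ℝ}
    (h : IsSplit ρ c g U f) (hv : c + f 0 / 2 ≤ -(P.energyPerParticle lennardJones)) (w : E3) :
    HasSum (fun y : P.points => f (dist w (y : E3))) 0 :=
  invisible P h.posType (f_nonpos_of_isSplit h)
    (Slackness.f_zero_add_two_mul_energyPerParticle_f h hv) w

/-- For a witness, the `f`-field is summable over the crystal with sum `0`, at every `w`.
[folklore] -/
theorem tsum_field_eq_zero_of_isSplit {P : PeriodicConfiguration 3} {ρ c : ℝ} {g U f : ℝ → ℝ}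
    (h : IsSplit ρ c g U f) (hv : c + f 0 / 2 ≤ -(P.energyPerParticle lennardJones)) (w : E3) :
    ∑' y : P.points, f (dist w (y : E3)) = 0 :=
  (invisible_of_isSplit h hv w).tsum_eq

/-- **Every site of the witness crystal is individually `f`-neutral**: `siteSum f p = −f 0` at
EVERY point `p` of `P` (not only on average over the motif). [folklore] -/
theorem siteSum_eq_neg_f_zero_of_isSplit {P : PeriodicConfiguration 3} {ρ c : ℝ} {g U f : ℝ → ℝ}
    (h : IsSplit ρ c g U f) (hv : c + f 0 / 2 ≤ -(P.energyPerParticle lennardJones))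
    {p : E3} (hp : p ∈ P.points) : siteSum P f p = -f 0 := by
  obtain ⟨x, hx, g', hg', rfl⟩ := hp
  rw [siteSum_add P f hg' x]
  have hs := summable_coset P h.posType (f_nonpos_of_isSplit h)
  exact siteSum_eq_neg P f hs (periodisation_posType P f h.posType hs)
    (Slackness.f_zero_add_two_mul_energyPerParticle_f h hv) hx

end Summit.AtomisticToContinuum.Crystallization.Theorems.ThreeConeCertificateExactCertificate.Field

end
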